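import Mathlib
import HarnessLib
import Literature.MathematicalPhysics.QuantumLattice.GrassmannEffectiveActionTruncationDB
import Summits.HubbardSuperconductivity.HubbardSuperconductivity.Theorems.KLProgrammeKLRegimeEngineScaleZeroE1Final
import Summits.HubbardSuperconductivity.HubbardSuperconductivity.Theorems.KLProgrammeKLRegimeEngineScaleZeroLevelZeroFrame
import Summits.HubbardSuperconductivity.HubbardSuperconductivity.Theorems.KLProgrammeKLRegimeEngineScaleZeroThetaPackage
import Summits.HubbardSuperconductivity.HubbardSuperconductivity.Theorems.KLProgrammeKLRegimeEngineV8DefsQ5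
import Summits.HubbardSuperconductivity.HubbardSuperconductivity.Theorems.KLProgrammeKLRegimeEngineV8TwoLegGridIncrementRep

/-!
# Route `KLProgramme` — crux K3 ENGINE (stmt-HubbardSuperconductivity-20437 `KLRegimeEngineV17F2`), stub (b) v2 / class #3 (E.5 share):
# THE SCALE-`0` PARTITION FUNCTION IS A UNIT AT EVERY ADMISSIBLE FRAME — the base `h0` of «(Z) along the blocks»
# (cell gate-hubbard-kl, seat gate-hubbard-kl-p5 g13; sibling of `…EnginePartitionFnUnits`; E1-LEVELS-BLUEPRINT-g8 §1/§4, RA-U-SUPPLY-g11 §7.3 item 5)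

`Z^K_{Λ_0} = hubbardEffPartitionFnCT L M β U μ 0 K (klScale klE0 0) = ∫dμ_{C^K_{>e₀}} e^{−(V + 𝒩_K)}` is the grid partition function
`∫dμ_{S_{4M}ᵀ C^K_{>e₀} S_{4M}} e^{−(V_{4M} + 𝒩_{K,4M})}` (`gridEffPartitionFn_eq_hubbardEffPartitionFnCT`, k3c2-p2), and the scale-`0` rung's ONE
determinant-bounded Gaussian step on the `4M` time grid (k3c2-p1's `klAnisoLegKernelNorm_zero_le_of_gridStep_bi` ∘ `_order` ∘ `kernelNormsV4_zero_of_klEng`)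
returns, as the FIRST conjunct of the Literature door `sum_norm_kernel_effAction_add_sum_cumulant_le_of_gramBounded`, that this partition function is a
unit — under the same data the kernel-norm clause (E1-v4)₀ uses and nothing else: the frame Gram constant `κ₀ = √(2(7+6047))`
(`isGramBoundedR_scaleZero_of_frameOK_sharp`), the decay size `klScaleZeroA0` (`rowSum/colSum_scaleZero_le_A0`, p3), the vertex profile
(`sum_norm_kernel_gridVertex_le_l1`, `sum_norm_framePosKernel_le_linear_of_frameOK`), the smallness `θ = klScaleZeroThetaC R·U ≤ 1/2` (`theta_scaleZero_eq`)
and the regime sizes (`scaleZero_regime_sizes`).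

* §1 `isUnit_hubbardEffPartitionFnCT_scaleZero_of_gridStep` — modulo the three numbers (κ, α, θ < 1), any frame;
* §2 **`isUnit_hubbardEffPartitionFnCT_scaleZero_of_klEng`** — at every admissible frame (`FrameOK R U N μ K`, `R.WF`, `0 < U ≤ 1`, `klBetaMin ≤ β`,
  `klEngL₃ β U ≤ L`, `klEngM₃ β U L ≤ M`) and the package smallness `klScaleZeroThetaC R·U ≤ 1/2`;
* §3 under the stub binders: **`hubbardEffPartitionFnCT_scaleZero_ne_zero_of_le_klEngU₀3`** (`U ≤ klEngU₀3 P R c`), `…_U9` (v1 tokens `klEngU₀9`, `klEngL₃`),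
  **`…_U10L4`** (v2 tokens `klEngU₀10`, `klEngL₄`) — in particular at every flow frame `K_n = klFlowFrameU … n` the binder `FrameOK R U (nScales β) μ K_n` gives
  `Z^{K_n}_{Λ_0} ≠ 0`, the `h0` of `hubbardEffPartitionFnCT_klScale_blocks_ne_zero` / `…_succ_ne_zero_of_steps`.
Everything is proved; no definitions, no named facts, no sorry; nothing asserts superconductivity.
References: BGM 2006 §2.1 (2.5)–(2.6), §2.3 (2.13)–(2.14), §3 (3.2)–(3.8) [cite: BenfattoGiulianiMastropietro2006].
-/

noncomputable section

namespace Summit.HubbardSuperconductivity.HubbardSuperconductivity.Theorems.EngineV8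

set_option linter.dupNamespace false -- summit = problem name (single-conjunct summit), D-0017

open Real Finset Literature.MathematicalPhysics.QuantumLattice Literature.Probability.LatticeModels GrassmannAlgebra
open Summit.HubbardSuperconductivity.HubbardSuperconductivity.Theorems.KLRegimeSplit
open Summit.HubbardSuperconductivity.HubbardSuperconductivity.Theorems.KLProgrammeLegKernels
open Summit.HubbardSuperconductivity.HubbardSuperconductivity.Theorems.ScaleZeroDecay

variable {L M : ℕ} [NeZero L]

/-! ## §1 The scale-`0` partition function from ONE determinant-bounded grid step, modulo the three numbers -/

/-- **`Z^K_{Λ_0}` is a unit, modulo `(κ, α, θ)`**: `S = hubbardGridSub L M β (4M)`, `C₀ = C^K_{>e₀}`; if `SᵀC₀S` is replica-Gram-bounded with constant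
`κ > 0` and has row and column sums `≤ α`, and `θ = eα‖Ṽ‖_h/κ² < 1` for the grid vertex's pinned profile (entry `kK ≥ Σ_z ‖Ǩ_L(z)‖`) and a weight `ρ > 0`,
then `hubbardEffPartitionFnCT L M β U μ 0 K (klScale klE0 0)` is a unit (BGM 2006 (2.13): `e^{−L²βF₀} ≠ 0`). -/
theorem isUnit_hubbardEffPartitionFnCT_scaleZero_of_gridStep [NeZero M] {β : ℝ} (hβ : 0 < β) (U μ : ℝ) (K : TrigPolyC4v) {kK : ℝ}
    (hkK : ∑ z : TorusSite 2 L, ‖framePosKernel L K z‖ ≤ kK) {κ : ℝ} (hκ : 0 < κ)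
    (hGB : IsGramBoundedR ((hubbardGridSub L M β (2 * (2 * M))).transpose * hubbardCovAboveCT L M β μ 0 K klE0 *
      hubbardGridSub L M β (2 * (2 * M))) κ)
    {α : ℝ} (hα : 0 < α)
    (hrow : ∀ X, ∑ Y, ‖((hubbardGridSub L M β (2 * (2 * M))).transpose * hubbardCovAboveCT L M β μ 0 K klE0 *
      hubbardGridSub L M β (2 * (2 * M))) X Y‖ ≤ α)
    (hcol : ∀ Y, ∑ X, ‖((hubbardGridSub L M β (2 * (2 * M))).transpose * hubbardCovAboveCT L M β μ 0 K klE0 *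
      hubbardGridSub L M β (2 * (2 * M))) X Y‖ ≤ α)
    {ρ : ℝ} (hρ : 0 < ρ)
    (hθ : Real.exp 1 * α * normV (GridLeg (GridPoint L (2 * (2 * M)))) κ ρ
      ((fun m' : ℕ => if m' = 1 then |β| / (2 * (2 * M) : ℕ) * kK else if m' = 2 then |U| * |β| / (2 * (2 * M) : ℕ) else 0)) / κ ^ 2 < 1) :
    IsUnit (hubbardEffPartitionFnCT L M β U μ 0 K (klScale klE0 0)) := by
  classical
  set Ng : ℕ := 2 * (2 * M) with hNg
  set Vt := hubbardGridInteraction L Ng β U + hubbardGridCounterQuadratic L Ng β K with hVt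
  have hVt_even : Vt ∈ evenPart ℂ (GridLeg (GridPoint L Ng)) :=
    add_mem (hubbardGridInteraction_mem_evenPart β U) (hubbardGridCounterQuadratic_mem_evenPart β K)
  have hVt0 : constPart ℂ Vt = 0 := by
    rw [hVt, map_add, constPart_hubbardGridInteraction, constPart_hubbardGridCounterQuadratic, add_zero]
  have hkK0 : 0 ≤ kK := le_trans (sum_nonneg fun _ _ => norm_nonneg _) hkK
  -- the determinant-bounded door on the grid algebra, first conjunct
  have hunit := (sum_norm_kernel_effAction_add_sum_cumulant_le_of_gramBounded
    ((hubbardGridSub L M β Ng).transpose * hubbardCovAboveCT L M β μ 0 K klE0 * hubbardGridSub L M β Ng) hκ hGB Vt hVt_even hVt0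
    (fun m' : ℕ => if m' = 1 then |β| / Ng * kK else if m' = 2 then |U| * |β| / Ng else 0) (scaleZeroPinnedL1_nonneg β U hkK0 Ng)
    (sum_norm_kernel_gridVertex_le_l1 β U K hkK) hα hrow hcol hρ hθ one_pos).1
  -- the grid partition function is `Z^K_{e₀}`, and `Λ_0 = e₀`
  have h0 : klScale klE0 0 = klE0 := by simp [klScale]
  rw [h0, ← gridEffPartitionFn_eq_hubbardEffPartitionFnCT hβ.ne' U μ K klE0]
  exact hunit

/-! ## §2 At every admissible frame, package smallness `klScaleZeroThetaC R·U ≤ 1/2` -/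

/-- **`Z^K_{Λ_0}` IS A UNIT ON EVERY ADMISSIBLE FRAME.**  Binders of the engine: `FrameOK R U N μ K`, `R.WF`, `0 < U ≤ 1`, `klBetaMin ≤ β`,
`klEngL₃ β U ≤ L`, `klEngM₃ β U L ≤ M`; package condition `klScaleZeroThetaC R·U ≤ 1/2` (the SAME number (E1-v4)₀ `kernelNormsV4_zero_of_klEng` and the
values clause `pairLadderStepAtV8_zero_of_klEng` use).  Data: `κ₀ = √(2(7+6047))` (`isGramBoundedR_scaleZero_of_frameOK_sharp`), `A₀ := klScaleZeroA0`
(`rowSum/colSum_scaleZero_le_A0`), `kK := klKappaFrameC R·|U|` (`sum_norm_framePosKernel_le_linear_of_frameOK`), `θ` by `theta_scaleZero_eq`. -/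
theorem isUnit_hubbardEffPartitionFnCT_scaleZero_of_klEng [NeZero M] {R : RenConsts} (hR : R.WF) {U : ℝ} (hU : 0 < U) (hU1 : U ≤ 1)
    {N : ℕ} {μ : ℝ} {K : TrigPolyC4v} (hK : FrameOK R U N μ K) {β : ℝ} (hβ : klBetaMin ≤ β)
    (hL : klEngL₃ β U ≤ L) (hM : klEngM₃ β U L ≤ M) (hθ : klScaleZeroThetaC R * U ≤ 1 / 2) :
    IsUnit (hubbardEffPartitionFnCT L M β U μ 0 K (klScale klE0 0)) := by
  -- regime sizes
  obtain ⟨-, hβL, -, -, hβ3M, -⟩ := scaleZero_regime_sizes (U := U) hβ hL hM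
  have hβpos : 0 < β := lt_of_lt_of_le (by norm_num [klBetaMin]) hβ
  have hMpos : (0 : ℝ) < M := by exact_mod_cast Nat.pos_of_ne_zero (NeZero.ne M)
  have hκ₀ : (0 : ℝ) < Real.sqrt (2 * (7 + 6047)) := Real.sqrt_pos.2 (by norm_num)
  have hA0 : 0 < klScaleZeroA0 := klScaleZeroA0_pos
  -- the sizes `A₀`, `kK`
  have hN4 : (((2 * (2 * M) : ℕ) : ℝ)) / β * klScaleZeroA0 = 4 * M * klScaleZeroA0 / β := by push_cast; ring
  have hrow : ∀ X, ∑ Y, ‖((hubbardGridSub L M β (2 * (2 * M))).transpose * hubbardCovAboveCT L M β μ 0 K klE0 *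
      hubbardGridSub L M β (2 * (2 * M))) X Y‖ ≤ 4 * M * klScaleZeroA0 / β := fun X => by
    rw [← hN4]; exact rowSum_scaleZero_le_A0 hK hβ hβ3M X
  have hcol : ∀ Y, ∑ X, ‖((hubbardGridSub L M β (2 * (2 * M))).transpose * hubbardCovAboveCT L M β μ 0 K klE0 *
      hubbardGridSub L M β (2 * (2 * M))) X Y‖ ≤ 4 * M * klScaleZeroA0 / β := fun Y => by
    rw [← hN4]; exact colSum_scaleZero_le_A0 hK hβ hβ3M Y
  have hkK := sum_norm_framePosKernel_le_linear_of_frameOK (L := L) hR hU.ne' (by rw [abs_of_pos hU]; exact hU1) hK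
  have hα : 0 < 4 * M * klScaleZeroA0 / β := by positivity
  -- `θ = klScaleZeroThetaC R · U ≤ 1/2 < 1`
  have hθ' : Real.exp 1 * (4 * M * klScaleZeroA0 / β) *
        normV (GridLeg (GridPoint L (2 * (2 * M)))) (Real.sqrt (2 * (7 + 6047))) (Real.sqrt (2 * (7 + 6047)))
          ((fun m' : ℕ => if m' = 1 then |β| / (2 * (2 * M) : ℕ) * (klKappaFrameC R * |U|)
            else if m' = 2 then |U| * |β| / (2 * (2 * M) : ℕ) else 0)) /
        Real.sqrt (2 * (7 + 6047)) ^ 2 < 1 := by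
    rw [theta_scaleZero_eq (L := L) hβpos U klScaleZeroA0 (klKappaFrameC R * |U|)]
    have heq : Real.exp 1 * klScaleZeroA0 * (4 * Real.exp 1 ^ 4 * (klKappaFrameC R * |U|) +
        16 * Real.exp 1 ^ 8 * Real.sqrt (2 * (7 + 6047)) ^ 2 * |U|) = klScaleZeroThetaC R * U := by
      rw [klScaleZeroThetaC, klScaleZeroCV, abs_of_pos hU]
      have he2 : Real.exp 2 = Real.exp 1 ^ 2 := by rw [← Real.exp_nat_mul]; norm_num
      rw [he2]
      field_simp
      ring
    rw [heq]
    linarith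
  exact isUnit_hubbardEffPartitionFnCT_scaleZero_of_gridStep hβpos U μ K hkK hκ₀ (isGramBoundedR_scaleZero_of_frameOK_sharp hK hβ hβL) hα hrow
    hcol hκ₀ hθ'

/-! ## §3 Under the stub binders -/

/-- **`Z^K_{Λ_0} ≠ 0` under the engine's binders at the scale-`0` threshold** `U ≤ klEngU₀3 P R c` (`⇒ U ≤ 1`, `klScaleZeroThetaC R·U ≤ 1/2` by
`le_one_of_le_klEngU₀3`, `klScaleZeroThetaC_mul_le_half_of_le_klEngU₀3`), any admissible frame. -/
theorem hubbardEffPartitionFnCT_scaleZero_ne_zero_of_le_klEngU₀3 [NeZero M] {P : SplitConsts} {R : RenConsts} (hR : R.WF) {c U : ℝ}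
    (hU : 0 < U) (hU₀ : U ≤ klEngU₀3 P R c) {N : ℕ} {μ : ℝ} {K : TrigPolyC4v} (hK : FrameOK R U N μ K) {β : ℝ} (hβ : klBetaMin ≤ β)
    (hL : klEngL₃ β U ≤ L) (hM : klEngM₃ β U L ≤ M) :
    hubbardEffPartitionFnCT L M β U μ 0 K (klScale klE0 0) ≠ 0 :=
  (isUnit_hubbardEffPartitionFnCT_scaleZero_of_klEng hR hU (le_one_of_le_klEngU₀3 hU₀) hK hβ hL hM
    (klScaleZeroThetaC_mul_le_half_of_le_klEngU₀3 hR hU hU₀)).ne_zero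

/-- **v1 binders** (tokens `klEngU₀9`, `klEngL₃`; `R.WF2`): `Z^K_{Λ_0} ≠ 0` at every admissible frame `K` (`FrameOK R U (nScales β) μ K`), in particular at
every flow frame `K_n` — the `h0` of `hubbardEffPartitionFnCT_klScale_blocks_ne_zero`. -/
theorem hubbardEffPartitionFnCT_scaleZero_ne_zero_frame_U9 (P : SplitConsts) (R : RenConsts) (c : ℝ) (hR : R.WF2) (μ : ℝ) (U : ℝ) (hU : 0 < U)
    (hU₉ : U ≤ klEngU₀9 P R c) (β : ℝ) (hβ : klBetaMin ≤ β) (K : TrigPolyC4v) (hK : FrameOK R U (nScales β) μ K) (L M : ℕ) [NeZero L] [NeZero M]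
    (hL : klEngL₃ β U ≤ L) (hM : klEngM₃ β U L ≤ M) :
    hubbardEffPartitionFnCT L M β U μ 0 K (klScale klE0 0) ≠ 0 :=
  hubbardEffPartitionFnCT_scaleZero_ne_zero_of_le_klEngU₀3 hR.wf hU (hU₉.trans (klEngU₀9_le_klEngU₀3 P R c)) hK hβ hL hM

/-- **v2 binders** (tokens `klEngU₀10`, `klEngL₄`; `R.WF2`): `Z^K_{Λ_0} ≠ 0` at every admissible frame `K` (`FrameOK R U (nScales β) μ K`). -/
theorem hubbardEffPartitionFnCT_scaleZero_ne_zero_frame_U10L4 (P : SplitConsts) (R : RenConsts) (c : ℝ) (hR : R.WF2) (μ : ℝ) (U : ℝ) (hU : 0 < U)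
    (hU₁₀ : U ≤ klEngU₀10 P R c) (β : ℝ) (hβ : klBetaMin ≤ β) (K : TrigPolyC4v) (hK : FrameOK R U (nScales β) μ K) (L M : ℕ) [NeZero L] [NeZero M]
    (hL : klEngL₄ P R β U ≤ L) (hM : klEngM₃ β U L ≤ M) :
    hubbardEffPartitionFnCT L M β U μ 0 K (klScale klE0 0) ≠ 0 :=
  hubbardEffPartitionFnCT_scaleZero_ne_zero_frame_U9 P R c hR μ U hU (hU₁₀.trans (klEngU₀10_le_klEngU₀9 P R c)) β hβ K hK L M
    (klEngL₃_le_of_klEngL₄_le hL) hM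

/-- **At the flow frame `K_n`, v2 binders, literally** (the shape the (ℓ) tower and the E.5 carrier read): for every `n`,
`FrameOK R U (nScales β) μ (klFlowFrameU L M β U μ n) ⇒ hubbardEffPartitionFnCT L M β U μ 0 (klFlowFrameU L M β U μ n) (klScale klE0 0) ≠ 0`. -/
theorem hubbardEffPartitionFnCT_scaleZero_ne_zero_flowFrame (P : SplitConsts) (R : RenConsts) (c : ℝ) (hR : R.WF2) (μ : ℝ) (U : ℝ) (hU : 0 < U)
    (hU₁₀ : U ≤ klEngU₀10 P R c) (β : ℝ) (hβ : klBetaMin ≤ β) (L M : ℕ) [NeZero L] [NeZero M] (hL : klEngL₄ P R β U ≤ L) (hM : klEngM₃ β U L ≤ M)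
    (n : ℕ) (hK : FrameOK R U (nScales β) μ (klFlowFrameU L M β U μ n)) :
    hubbardEffPartitionFnCT L M β U μ 0 (klFlowFrameU L M β U μ n) (klScale klE0 0) ≠ 0 :=
  hubbardEffPartitionFnCT_scaleZero_ne_zero_frame_U10L4 P R c hR μ U hU hU₁₀ β hβ _ hK L M hL hM

end Summit.HubbardSuperconductivity.HubbardSuperconductivity.Theorems.EngineV8

end
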